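import Mathlib.Algebra.QuadraticAlgebra.Basic
import Mathlib.NumberTheory.Padics.RingHoms
import Mathlib.NumberTheory.Padics.ProperSpace
import Mathlib.Analysis.Normed.Ring.Units
import Mathlib.Topology.Algebra.Group.Basic
import Mathlib.Topology.MetricSpace.Ultra.TotallySeparated
import HarnessLib

/-!
# The quadratic order `ℤ_p[√p]` and its principal units `U = 1 + √p·ℤ_p[√p]`: a compact abelian
# topological group of rank two with a closed NON-open line `U_ℝ = U ∩ ℤ_p`

Topic `Literature/GroupTheory/SpecificGroups`.  Classical («folklore») material recorded as a concrete CARRIER,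
in the format of the companion file `PadicAffineGroup.lean` (`Aff(ℤ_p) = ℤ_p ⋊ ℤ_pˣ`):

* `PadicQuad p` — the quadratic order `R = ℤ_p[π]`, `π² = p` (Mathlib's `QuadraticAlgebra ℤ_[p] p 0`, pairs
  `x = re x + im x · π`); it is a DOMAIN: `re² = p · im²` forces `re = im = 0` by the parity of the `p`-adic
  valuation (`X² − p` is Eisenstein), so `x · y = 0 → x = 0 ∨ y = 0` (`PadicQuad.mul_eq_zero_iff`) — the
  «anisotropic torus / no `ℚ_p`-eigenline» property;
* `PadicQuadOneUnits p` — the principal units `U = 1 + πR = {x : re x ≡ 1 (mod p)}` as a compact, Hausdorff,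
  totally disconnected commutative topological group (coordinates `(re, im) ∈ ℤ_p × ℤ_p`); its REAL line
  `U_ℝ = U ∩ ℤ_p` (closed, infinite, NOT open) is treated in `PadicQuadraticAffineLevel.lean`.

(References for the profinite formalism: L. Ribes, P. Zalesskii, *Profinite Groups*, 2nd ed., Springer 2010,
§2.1; the computations are elementary and carried out here — OUR kernel check, no published claim is asserted.
The `[cite: …]` tags locate the DEFINITIONS this carrier is built to instantiate: [SemiAnbd] §5 Def 5.3 p. 65 —
the arithmetic quotient `Π_A` of an augmentation `Π^temp_𝔊 ↠ Π_A`, arithmetic ampleness = open image.)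

Purpose in the tree (cell abc-iut, layer L3, row «NV-T54-RESIDUAL stage 1», design of abc-iut-w4-d029 gen 6
HANDOFF #2 — there with the unramified twin `ℤ_p[i]`, `p ≡ 3 (4)`; the mechanism is only «`R` is a domain of
rank two over `ℤ_p`», which `π = √p` supplies for EVERY prime): `U` is the `Π_A` of the affine carrier
`PadicQuadraticAffineGroup.lean`, on which the joint non-vacuity witness
`Literature/AnabelianGeometry/SemiGraphs/ArithTotalEstrangementTransportWitness.lean` for the hypotheses of
[SemiAnbd] Thm 5.4 is built.  Mathlib only: no statement of any IUT paper is touched here; no side is taken on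
[IUTchIII] Cor 3.12.
-/

noncomputable section

namespace Literature.GroupTheory.SpecificGroups

open Topology Filter Set
open scoped QuadraticAlgebra

variable (p : ℕ) [Fact p.Prime]

/-! ### The quadratic order `R = ℤ_p[π]`, `π² = p` -/

/-- The quadratic order `ℤ_p[π]` with `π² = p`: Mathlib's quadratic algebra `QuadraticAlgebra ℤ_[p] p 0`
(elements `⟨re, im⟩ = re + im·π`, `(x y).re = x.re y.re + p x.im y.im`, `(x y).im = x.re y.im + x.im y.re`).
[cite: MochizukiSemiAnbd2006, Def 5.3 (i), p. 65] -/
abbrev PadicQuad : Type := QuadraticAlgebra ℤ_[p] (p : ℤ_[p]) 0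

namespace PadicQuad

variable {p}

/-- `re² = p · im²` in `ℤ_p` forces `re = im = 0` (parity of the valuation: `2 v(re) = 1 + 2 v(im)` is
impossible). [cite: MochizukiSemiAnbd2006, Def 5.3 (i), p. 65] -/
theorem eq_zero_of_sq_eq_p_mul_sq {x y : ℤ_[p]} (h : x * x = (p : ℤ_[p]) * (y * y)) : x = 0 ∧ y = 0 := by
  have hp0 : (p : ℤ_[p]) ≠ 0 := PadicInt.irreducible_p.ne_zero
  by_cases hy : y = 0
  · subst hy
    simp only [mul_zero] at h
    exact ⟨mul_self_eq_zero.mp h, rfl⟩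
  · exfalso
    have hx : x ≠ 0 := by
      rintro rfl
      simp only [zero_mul] at h
      exact hy (mul_self_eq_zero.mp (mul_eq_zero.mp h.symm |>.resolve_left hp0))
    have hv := congrArg PadicInt.valuation h
    rw [PadicInt.valuation_mul hx hx, PadicInt.valuation_mul hp0 (mul_ne_zero hy hy),
      PadicInt.valuation_mul hy hy, PadicInt.valuation_p] at hv
    omega

/-- The norm form `re² − p·im²` vanishes only at `0`. [cite: MochizukiSemiAnbd2006, Def 5.3 (i), p. 65] -/
theorem norm_eq_zero_iff (x : PadicQuad p) : QuadraticAlgebra.norm x = 0 ↔ x = 0 := by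
  constructor
  · intro h
    rw [QuadraticAlgebra.norm_def] at h
    have h' : x.re * x.re = (p : ℤ_[p]) * (x.im * x.im) := by linear_combination h
    obtain ⟨hre, him⟩ := eq_zero_of_sq_eq_p_mul_sq h'
    ext <;> simp [hre, him]
  · rintro rfl
    exact QuadraticAlgebra.norm_zero

/-- **`ℤ_p[√p]` is a domain**: `x y = 0 → x = 0 ∨ y = 0` (multiply by the conjugate `star x`:
`norm x · y = 0`, and `norm x ≠ 0` for `x ≠ 0`). [cite: MochizukiSemiAnbd2006, Def 5.3 (i), p. 65] -/
theorem mul_eq_zero_iff (x y : PadicQuad p) : x * y = 0 ↔ x = 0 ∨ y = 0 := by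
  constructor
  · intro h
    by_cases hx : x = 0
    · exact Or.inl hx
    · right
      have hn : QuadraticAlgebra.norm x ≠ 0 := fun h0 => hx ((norm_eq_zero_iff x).mp h0)
      have key : (algebraMap ℤ_[p] (PadicQuad p) (QuadraticAlgebra.norm x)) * y = 0 := by
        rw [QuadraticAlgebra.algebraMap_norm_eq_mul_star, mul_comm x, mul_assoc, h, mul_zero]
      rw [QuadraticAlgebra.algebraMap_eq] at key
      have k1 := congrArg QuadraticAlgebra.re key
      have k2 := congrArg QuadraticAlgebra.im key
      simp only [QuadraticAlgebra.re_mul, QuadraticAlgebra.im_mul, mul_zero, zero_mul, add_zero,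
        QuadraticAlgebra.re_zero, QuadraticAlgebra.im_zero, mul_eq_zero, hn, false_or] at k1 k2
      ext <;> simp [k1, k2]
  · rintro (rfl | rfl) <;> simp

/-- Cancellation in the domain `ℤ_p[√p]`: `(v − 1)·c = 0` with `c ≠ 0` forces `v = 1`.
[cite: MochizukiSemiAnbd2006, Def 5.3 (ii), p. 65] -/
theorem eq_one_of_sub_one_mul_eq_zero {v c : PadicQuad p} (h : (v - 1) * c = 0) (hc : c ≠ 0) : v = 1 :=
  sub_eq_zero.mp (((mul_eq_zero_iff _ _).mp h).resolve_right hc)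

/-- A principal unit `x` (`‖re x − 1‖ < 1`) has `‖re x‖ = 1`. [cite: MochizukiSemiAnbd2006, Def 5.3 (i), p. 65] -/
theorem norm_re_eq_one {x : ℤ_[p]} (hx : ‖x - 1‖ < 1) : ‖x‖ = 1 := by
  apply le_antisymm (PadicInt.norm_le_one x)
  by_contra hlt
  rw [not_le] at hlt
  have : ‖(1 : ℤ_[p])‖ < 1 := by
    have e : (1 : ℤ_[p]) = x + -(x - 1) := by ring
    rw [e]
    refine (PadicInt.nonarchimedean _ _).trans_lt (max_lt hlt ?_)
    rwa [norm_neg]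
  simp at this

/-- The norm form of a principal unit is a principal unit of `ℤ_p`: `‖re² − p im² − 1‖ < 1`.
[cite: MochizukiSemiAnbd2006, Def 5.3 (i), p. 65] -/
theorem norm_norm_sub_one_lt {x : PadicQuad p} (hx : ‖x.re - 1‖ < 1) :
    ‖QuadraticAlgebra.norm x - 1‖ < 1 := by
  rw [QuadraticAlgebra.norm_def]
  have e : x.re * x.re + 0 * x.re * x.im - (p : ℤ_[p]) * x.im * x.im - 1 =
      (x.re - 1) * (x.re + 1) + -((p : ℤ_[p]) * (x.im * x.im)) := by ring
  rw [e]
  refine (PadicInt.nonarchimedean _ _).trans_lt (max_lt ?_ ?_)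
  · rw [norm_mul]
    exact (mul_le_of_le_one_right (norm_nonneg _) (PadicInt.norm_le_one _)).trans_lt hx
  · rw [norm_neg, norm_mul, PadicInt.norm_p]
    refine (mul_le_of_le_one_right (by positivity) (PadicInt.norm_le_one _)).trans_lt ?_
    exact inv_lt_one_of_one_lt₀ (by exact_mod_cast (Fact.out : p.Prime).one_lt)

/-- A principal unit is a unit of `ℤ_p[√p]` (its norm form is a unit of `ℤ_p`).
[cite: MochizukiSemiAnbd2006, Def 5.3 (i), p. 65] -/
theorem isUnit_of_norm_re_sub_one_lt {x : PadicQuad p} (hx : ‖x.re - 1‖ < 1) : IsUnit x :=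
  QuadraticAlgebra.isUnit_iff_norm_isUnit.mpr
    (PadicInt.isUnit_iff.mpr (norm_re_eq_one (norm_norm_sub_one_lt hx)))

/-- Products of principal units are principal units: `‖(x y).re − 1‖ < 1`.
[cite: MochizukiSemiAnbd2006, Def 5.3 (i), p. 65] -/
theorem norm_re_mul_sub_one_lt {x y : PadicQuad p} (hx : ‖x.re - 1‖ < 1) (hy : ‖y.re - 1‖ < 1) :
    ‖(x * y).re - 1‖ < 1 := by
  rw [QuadraticAlgebra.re_mul]
  have e : x.re * y.re + (p : ℤ_[p]) * x.im * y.im - 1 =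
      ((x.re - 1) * y.re + (y.re - 1)) + (p : ℤ_[p]) * (x.im * y.im) := by ring
  rw [e]
  refine (PadicInt.nonarchimedean _ _).trans_lt (max_lt ((PadicInt.nonarchimedean _ _).trans_lt
    (max_lt ?_ hy)) ?_)
  · rw [norm_mul]
    exact (mul_le_of_le_one_right (norm_nonneg _) (PadicInt.norm_le_one _)).trans_lt hx
  · rw [norm_mul, PadicInt.norm_p]
    refine (mul_le_of_le_one_right (by positivity) (PadicInt.norm_le_one _)).trans_lt ?_
    exact inv_lt_one_of_one_lt₀ (by exact_mod_cast (Fact.out : p.Prime).one_lt)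

/-- `re (f·g)` is continuous when the coordinates of `f`, `g` are. [cite: MochizukiSemiAnbd2006, Def 5.3 (i), p. 65] -/
theorem continuous_re_mul {X : Type*} [TopologicalSpace X] {f g : X → PadicQuad p}
    (hfr : Continuous fun x => (f x).re) (hfi : Continuous fun x => (f x).im)
    (hgr : Continuous fun x => (g x).re) (hgi : Continuous fun x => (g x).im) :
    Continuous fun x => (f x * g x).re := by
  simp only [QuadraticAlgebra.re_mul]
  exact (hfr.mul hgr).add ((continuous_const.mul hfi).mul hgi)

/-- `im (f·g)` is continuous when the coordinates of `f`, `g` are. [cite: MochizukiSemiAnbd2006, Def 5.3 (i), p. 65] -/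
theorem continuous_im_mul {X : Type*} [TopologicalSpace X] {f g : X → PadicQuad p}
    (hfr : Continuous fun x => (f x).re) (hfi : Continuous fun x => (f x).im)
    (hgr : Continuous fun x => (g x).re) (hgi : Continuous fun x => (g x).im) :
    Continuous fun x => (f x * g x).im := by
  simp only [QuadraticAlgebra.im_mul, zero_mul, add_zero]
  exact (hfr.mul hgi).add (hfi.mul hgr)

end PadicQuad

/-! ### The principal units `U = 1 + π ℤ_p[π]` as a compact topological group -/

/-- The principal units `U = 1 + πR` of `R = ℤ_p[√p]`: elements `x ∈ R` with `re x ≡ 1 (mod p)`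
(`im x` arbitrary). [cite: MochizukiSemiAnbd2006, Def 5.3 (i), p. 65] -/
@[ext] structure PadicQuadOneUnits : Type where
  /-- the underlying element of `ℤ_p[√p]` -/
  val : PadicQuad p
  /-- principal: `‖re − 1‖ < 1` -/
  norm_re_sub_one_lt : ‖val.re - 1‖ < 1

namespace PadicQuadOneUnits

variable {p}

/-- Multiplication of principal units. [cite: MochizukiSemiAnbd2006, Def 5.3 (i), p. 65] -/
instance : Mul (PadicQuadOneUnits p) :=
  ⟨fun x y => ⟨x.val * y.val, PadicQuad.norm_re_mul_sub_one_lt x.2 y.2⟩⟩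

/-- The unit. [cite: MochizukiSemiAnbd2006, Def 5.3 (i), p. 65] -/
instance : One (PadicQuadOneUnits p) := ⟨⟨1, by simp⟩⟩

/-- The real part of the inverse `star x · (norm x)⁻¹` is again `≡ 1 (mod p)`.
[cite: MochizukiSemiAnbd2006, Def 5.3 (i), p. 65] -/
theorem norm_re_inv_sub_one_lt (x : PadicQuadOneUnits p) :
    ‖(star x.val * algebraMap ℤ_[p] (PadicQuad p) (Ring.inverse (QuadraticAlgebra.norm x.val))).re
      - 1‖ < 1 := by
  set n := QuadraticAlgebra.norm x.val with hn
  have hnu : IsUnit n := PadicInt.isUnit_iff.mpr (PadicQuad.norm_re_eq_one (PadicQuad.norm_norm_sub_one_lt x.2))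
  have hinv : Ring.inverse n * n = 1 := Ring.inverse_mul_cancel n hnu
  have hre : (star x.val * algebraMap ℤ_[p] (PadicQuad p) (Ring.inverse n)).re =
      x.val.re * Ring.inverse n := by
    simp [QuadraticAlgebra.algebraMap_eq, QuadraticAlgebra.re_star]
  rw [hre]
  have e : x.val.re * Ring.inverse n - 1 =
      (x.val.re - 1) * Ring.inverse n + -((n - 1) * Ring.inverse n) := by
    linear_combination hinv
  rw [e]
  refine (PadicInt.nonarchimedean _ _).trans_lt (max_lt ?_ ?_)
  · rw [norm_mul]
    exact (mul_le_of_le_one_right (norm_nonneg _) (PadicInt.norm_le_one _)).trans_lt x.2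
  · rw [norm_neg, norm_mul]
    exact (mul_le_of_le_one_right (norm_nonneg _) (PadicInt.norm_le_one _)).trans_lt
      (PadicQuad.norm_norm_sub_one_lt x.2)

/-- Inversion of principal units: `x⁻¹ = star x · (norm x)⁻¹`. [cite: MochizukiSemiAnbd2006, Def 5.3 (i), p. 65] -/
instance : Inv (PadicQuadOneUnits p) :=
  ⟨fun x => ⟨star x.val * algebraMap ℤ_[p] (PadicQuad p) (Ring.inverse (QuadraticAlgebra.norm x.val)),
    norm_re_inv_sub_one_lt x⟩⟩

/-- Value of a product. [cite: MochizukiSemiAnbd2006, Def 5.3 (i), p. 65] -/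
@[simp] theorem val_mul (x y : PadicQuadOneUnits p) : (x * y).val = x.val * y.val := rfl

/-- Value of the unit. [cite: MochizukiSemiAnbd2006, Def 5.3 (i), p. 65] -/
@[simp] theorem val_one : (1 : PadicQuadOneUnits p).val = 1 := rfl

/-- Value of the inverse. [cite: MochizukiSemiAnbd2006, Def 5.3 (i), p. 65] -/
theorem val_inv (x : PadicQuadOneUnits p) :
    x⁻¹.val = star x.val * algebraMap ℤ_[p] (PadicQuad p) (Ring.inverse (QuadraticAlgebra.norm x.val)) :=
  rfl

/-- `x⁻¹ · x = 1` in `ℤ_p[√p]`. [cite: MochizukiSemiAnbd2006, Def 5.3 (i), p. 65] -/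
@[simp] theorem val_inv_mul_val (x : PadicQuadOneUnits p) : x⁻¹.val * x.val = 1 := by
  have hnu : IsUnit (QuadraticAlgebra.norm x.val) :=
    PadicInt.isUnit_iff.mpr (PadicQuad.norm_re_eq_one (PadicQuad.norm_norm_sub_one_lt x.2))
  rw [val_inv, mul_assoc, mul_comm _ x.val, ← mul_assoc, mul_comm (star x.val),
    ← QuadraticAlgebra.algebraMap_norm_eq_mul_star, ← map_mul, mul_comm,
    Ring.inverse_mul_cancel _ hnu, map_one]

/-- `x · x⁻¹ = 1` in `ℤ_p[√p]`. [cite: MochizukiSemiAnbd2006, Def 5.3 (i), p. 65] -/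
@[simp] theorem val_mul_val_inv (x : PadicQuadOneUnits p) : x.val * x⁻¹.val = 1 := by
  rw [mul_comm, val_inv_mul_val]

/-- The principal units form a group. [cite: MochizukiSemiAnbd2006, Def 5.3 (i), p. 65] -/
instance : Group (PadicQuadOneUnits p) where
  mul_assoc x y z := by ext1; simp [mul_assoc]
  one_mul x := by ext1; simp
  mul_one x := by ext1; simp
  inv_mul_cancel x := by ext1; simp

/-- The principal units form a commutative group. [cite: MochizukiSemiAnbd2006, Def 5.3 (i), p. 65] -/
instance : CommGroup (PadicQuadOneUnits p) where
  mul_comm x y := by ext1; simp [mul_comm]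

/-- A principal unit has `‖re‖ = 1`; in particular `re ≠ 0`. [cite: MochizukiSemiAnbd2006, Def 5.3 (i), p. 65] -/
theorem norm_re_eq_one (x : PadicQuadOneUnits p) : ‖x.val.re‖ = 1 := PadicQuad.norm_re_eq_one x.2

/-- A principal unit has `re ≠ 0`. [cite: MochizukiSemiAnbd2006, Def 5.3 (i), p. 65] -/
theorem re_ne_zero (x : PadicQuadOneUnits p) : x.val.re ≠ 0 := by
  intro h; have := norm_re_eq_one x; rw [h, norm_zero] at this; exact zero_ne_one this

/-- The coordinates `(re, im) ∈ ℤ_p × ℤ_p`. [cite: MochizukiSemiAnbd2006, Def 5.3 (i), p. 65] -/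
def coord (x : PadicQuadOneUnits p) : ℤ_[p] × ℤ_[p] := (x.val.re, x.val.im)

/-- The coordinate map is injective. [cite: MochizukiSemiAnbd2006, Def 5.3 (i), p. 65] -/
theorem coord_injective : Function.Injective (coord (p := p)) := by
  intro x y h
  simp only [coord, Prod.mk.injEq] at h
  exact PadicQuadOneUnits.ext (QuadraticAlgebra.ext h.1 h.2)

/-- The range of the coordinates: `{(s, t) : ‖s − 1‖ < 1}`. [cite: MochizukiSemiAnbd2006, Def 5.3 (i), p. 65] -/
theorem range_coord : range (coord (p := p)) = {q | ‖q.1 - 1‖ < 1} := by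
  ext q
  constructor
  · rintro ⟨x, rfl⟩
    exact x.2
  · intro hq
    exact ⟨⟨⟨q.1, q.2⟩, hq⟩, rfl⟩

/-- The topology: induced by the coordinates from `ℤ_p × ℤ_p`. [cite: MochizukiSemiAnbd2006, Def 5.3 (i), p. 65] -/
instance : TopologicalSpace (PadicQuadOneUnits p) := TopologicalSpace.induced coord inferInstance

/-- The coordinate map is an embedding. [cite: MochizukiSemiAnbd2006, Def 5.3 (i), p. 65] -/
theorem isEmbedding_coord : IsEmbedding (coord (p := p)) := ⟨⟨rfl⟩, coord_injective⟩

/-- The coordinate map is continuous. [cite: MochizukiSemiAnbd2006, Def 5.3 (i), p. 65] -/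
theorem continuous_coord : Continuous (coord (p := p)) := continuous_induced_dom

/-- `re` is continuous. [cite: MochizukiSemiAnbd2006, Def 5.3 (i), p. 65] -/
theorem continuous_re : Continuous fun x : PadicQuadOneUnits p => x.val.re :=
  continuous_fst.comp continuous_coord

/-- `im` is continuous. [cite: MochizukiSemiAnbd2006, Def 5.3 (i), p. 65] -/
theorem continuous_im : Continuous fun x : PadicQuadOneUnits p => x.val.im :=
  continuous_snd.comp continuous_coord

/-- A map into the principal units is continuous iff its two coordinates are.
[cite: MochizukiSemiAnbd2006, Def 5.3 (i), p. 65] -/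
theorem continuous_of_coord {X : Type*} [TopologicalSpace X] {f : X → PadicQuadOneUnits p}
    (h1 : Continuous fun x => (f x).val.re) (h2 : Continuous fun x => (f x).val.im) : Continuous f := by
  rw [continuous_induced_rng]
  exact h1.prodMk h2

/-- The inverse of the norm form is continuous (inversion is continuous on the units of the complete
normed ring `ℤ_p`). [cite: MochizukiSemiAnbd2006, Def 5.3 (i), p. 65] -/
theorem continuous_inverse_norm :
    Continuous fun x : PadicQuadOneUnits p => Ring.inverse (QuadraticAlgebra.norm x.val) := by
  have hc : Continuous fun x : PadicQuadOneUnits p => QuadraticAlgebra.norm x.val := by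
    simp only [QuadraticAlgebra.norm_def]
    exact ((continuous_re.mul continuous_re).add ((continuous_const.mul continuous_re).mul
      continuous_im)).sub ((continuous_const.mul continuous_im).mul continuous_im)
  refine continuous_iff_continuousAt.2 fun x => ?_
  have hnu : IsUnit (QuadraticAlgebra.norm x.val) :=
    PadicInt.isUnit_iff.mpr (PadicQuad.norm_re_eq_one (PadicQuad.norm_norm_sub_one_lt x.2))
  exact ContinuousAt.comp (f := fun x : PadicQuadOneUnits p => QuadraticAlgebra.norm x.val) (x := x)
    (NormedRing.inverse_continuousAt hnu.unit) hc.continuousAt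

/-- The principal units form a topological group. [cite: MochizukiSemiAnbd2006, Def 5.3 (i), p. 65] -/
instance : IsTopologicalGroup (PadicQuadOneUnits p) where
  continuous_mul := by
    apply continuous_of_coord
    · exact PadicQuad.continuous_re_mul (continuous_re.comp continuous_fst) (continuous_im.comp continuous_fst)
        (continuous_re.comp continuous_snd) (continuous_im.comp continuous_snd)
    · exact PadicQuad.continuous_im_mul (continuous_re.comp continuous_fst) (continuous_im.comp continuous_fst)
        (continuous_re.comp continuous_snd) (continuous_im.comp continuous_snd)
  continuous_inv := by
    apply continuous_of_coord
    · have e : (fun x : PadicQuadOneUnits p => x⁻¹.val.re) =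
          fun x => x.val.re * Ring.inverse (QuadraticAlgebra.norm x.val) := by
        funext x; simp [val_inv, QuadraticAlgebra.algebraMap_eq]
      rw [e]
      exact continuous_re.mul continuous_inverse_norm
    · have e : (fun x : PadicQuadOneUnits p => x⁻¹.val.im) =
          fun x => -x.val.im * Ring.inverse (QuadraticAlgebra.norm x.val) := by
        funext x; simp [val_inv, QuadraticAlgebra.algebraMap_eq]
      rw [e]
      exact continuous_im.neg.mul continuous_inverse_norm

/-- Hausdorff. [cite: MochizukiSemiAnbd2006, Def 5.3 (i), p. 65] -/
instance : T2Space (PadicQuadOneUnits p) := isEmbedding_coord.t2Space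

/-- Totally disconnected. [cite: MochizukiSemiAnbd2006, Def 5.3 (i), p. 65] -/
instance : TotallyDisconnectedSpace (PadicQuadOneUnits p) :=
  isEmbedding_coord.isTotallyDisconnected_range.mp (isTotallyDisconnected_of_totallyDisconnectedSpace _)

/-- `{s : ‖s − 1‖ < 1} = {s : ‖s − 1‖ ≤ p⁻¹}` is closed in `ℤ_p`. [cite: MochizukiSemiAnbd2006, Def 5.3 (i), p. 65] -/
theorem isClosed_norm_sub_one_lt : IsClosed {s : ℤ_[p] | ‖s - 1‖ < 1} := by
  have e : {s : ℤ_[p] | ‖s - 1‖ < 1} = {s : ℤ_[p] | ‖s - 1‖ ≤ (p : ℝ) ^ (-1 : ℤ)} := by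
    ext s
    simp only [mem_setOf_eq]
    rw [PadicInt.norm_le_pow_iff_norm_lt_pow_add_one]
    norm_num
  rw [e]
  exact isClosed_le (continuous_norm.comp (continuous_id.sub continuous_const)) continuous_const

/-- Compact: the coordinates form a closed subset of the compact `ℤ_p × ℤ_p`.
[cite: MochizukiSemiAnbd2006, Def 5.3 (i), p. 65] -/
instance : CompactSpace (PadicQuadOneUnits p) := by
  constructor
  rw [isEmbedding_coord.isInducing.isCompact_iff, image_univ, range_coord]
  exact (isClosed_norm_sub_one_lt.preimage continuous_fst).isCompact

end PadicQuadOneUnits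

end Literature.GroupTheory.SpecificGroups
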